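import Summits.Ventures.CertifiedQuantumChemistry.Rows.SingletNecessaryConditionLowerRows
import Summits.Ventures.CertifiedQuantumChemistry.Rows.SingletSpinAdaptationLosslessBlocks
import HarnessLib

/-!
# Ventures/CertifiedQuantumChemistry — Rows/SingletSpinAdaptedLowerRows.lean: SINGLET lower rows
# (`e0S0[…]`) from the SPIN-ADAPTED (`su2`, six-block) 2-RDM programme, and why they lose nothing

HONEST FRAMING (verbatim): certified bounds for a stated model Hamiltonian in a stated basis; not a
claim about the real molecule or material beyond that model.

LADDER-CHEM I-TYPE slot 03c (cell chem-oracle, seat chem-type-03 gen 3, 2026-08-27; zero compute; PROVED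
glue only — 0 sorry, no `def`, no claim node; nothing here asserts a bound about any pinned file). The
row-level end of the spin-adaptation chain `GMatrixSingletBlocks` → `SpinAdaptedPairOfSinglet`
(`isSpinAdaptedPair_rdm`) → `D/Q/GConditionSpinAdapted` (`⪰ 0 ⟺` two blocks each) →
`SpinAdaptedSingletLowerBound` (`le_minEnergyOn_singlet_of_forall_spinAdapted`, Literature, which cannot
name the venture's row predicate) → `Rows/SingletSpinAdaptationLosslessBlocks` (the VALUE is unchanged).
Sibling of `Rows/SingletNecessaryConditionLowerRows.lean` (chem-type-07: `SingletLowerRow F n lo` from an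
ARBITRARY singlet-necessary condition set) and `Rows/SingletSpinFlipQuotient.lean` (the `M = 0` flip
quotient `qcl1f`, of record) — none edited:
* §1 `isNecessaryInSpinClass_isSpinAdaptedPair` — the seven `IsSpinAdaptedPair` relation families are
  SINGLET-CLASS NECESSARY at `(n, n)` (`isSpinAdaptedPair_rdm`); with the rung structures:
  `isNecessaryInSpinClass_isDQGFeasibleSinglet_spinAdapted`, `…T1T2Prime…`.
* §2 **`singletLowerRow_of_forall_spinAdapted`** — model `F : Model k`, `n ≤ k`, `lo` below `Re E_F` on the
  SPIN-ADAPTED singlet-feasible pairs ⇒ `SingletLowerRow F n lo` (`lo ≤ E₀(H_F; N = 2n, S = 0)`); the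
  `PQGT1T2′` twin; **`singletLowerRow_of_forall_sixBlocks`** — the same with the six spin-coupled blocks
  `Γ⁰, Γ¹, 𝒬⁰, 𝒬¹, 𝒢⁰, 𝒢¹ ⪰ 0` as the positivity hypotheses a singlet-adapted instance actually carries
  ("only two distinct blocks must be constrained", Mazziotti p. 49) — what a certified dual bound of an
  `su2`-blocked `s2=0` instance means for the MODEL. No symmetry hypothesis on `F`.
* §3 **`forall_spinAdapted_iff_le_pqgSingletEnergy`** — NOTHING IS LOST: for `F`'s tables, `lo` lies below
  `Re E_F` on the spin-adapted singlet-feasible pairs iff `lo ≤ E_PQG(2n, S = 0)` of the printed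
  (unadapted) singlet programme (`le_pqgSingletEnergy_iff_spinAdapted` at `Λ = Fin k`); hence the rows
  certifiable through §2 at the `DQG` rung are EXACTLY those certifiable from the printed singlet `DQG`
  programme (`singletLowerRow_of_le_pqgSingletEnergy` ∘ §3 = §2), and likewise at `PQGT1T2′`.
Cell context (words): chem-solver-2 DESIGN R3 "full SU(2) coupling (÷3–4 memory, ÷6–8 flops) — UNTRIED";
these are the decls such an instance's certificate would cite, and §3 says the lever costs no bound.
References: D. A. Mazziotti, Adv. Chem. Phys. 134 (2007) ch. 3 §II.F pp. 47–49, §II.F.1 eqs. (96)–(98)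
(held copy pp. 47–50 opened); K. Gatermann, P. A. Parrilo, J. Pure Appl. Algebra 192 (2004) §3 Thm 3.3
(held copy p. 8 opened); in-house FORMAT-qcl1 §2 [N3] (option `s2=0`).
Tree (REUSED): `singletLowerRow_of_forall_necessary`, `isNecessaryInSpinClass_isDQGFeasibleSinglet`,
`isNecessaryInSpinClass_isDQGT1T2PrimeFeasibleSinglet`, `IsNecessaryInSpinClass.and` (chem-type-07 /
Literature `SpinClassNecessaryConditions`); `isSpinAdaptedPair_rdm`, `spinAdaptedBlocks_of_isDQGFeasibleSinglet`
(this seat, Literature); `le_pqgSingletEnergy_iff_spinAdapted`, `le_pqgT1T2pSingletEnergy_iff_spinAdapted`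
(`Rows/SingletSpinAdaptationLosslessBlocks`); `pqgSingletEnergy_le_minEnergyOn_singlet`,
`pqgT1T2pSingletEnergy_le_minEnergyOn_singlet` (typer, `SingletRestrictedRelaxation`).
-/

noncomputable section

namespace Summit.Ventures.CertifiedQuantumChemistry

open Matrix Finset
open Literature.MathematicalPhysics.QuantumLattice Literature.MathematicalPhysics.QuantumChemistry
open scoped ComplexOrder

/-! ## §1 The spin-adaptation relations are singlet-class necessary -/

section Necessary

variable {Λ : Type*} [LinearOrder Λ] [Fintype Λ]

/-- **The `IsSpinAdaptedPair` relations are SINGLET-CLASS NECESSARY at `(n, n)`**: the RDM pair of every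
unit `(n, n)`-sector vector annihilated by `Ŝ_+` obeys them (`isSpinAdaptedPair_rdm`) — the rows a
singlet-adapted instance imposes as equalities are rows of Mazziotti's `S`-representable class.
[cite: Mazziotti2007RDMChapter, §II.F.1 eqs. (96)-(98)] -/
theorem isNecessaryInSpinClass_isSpinAdaptedPair (n : ℕ) :
    IsNecessaryInSpinClass (Λ := Λ) n n fun γ Γ => IsSpinAdaptedPair γ Γ :=
  fun _ hψ hS _ => isSpinAdaptedPair_rdm hψ hS

/-- The spin-adapted singlet `DQG` condition set (`IsDQGFeasibleSinglet n ∧ IsSpinAdaptedPair`) is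
singlet-class necessary. [cite: Mazziotti2007RDMChapter, §II.F.1 eqs. (96)-(98)] -/
theorem isNecessaryInSpinClass_isDQGFeasibleSinglet_spinAdapted (n : ℕ) :
    IsNecessaryInSpinClass (Λ := Λ) n n fun γ Γ => IsDQGFeasibleSinglet n γ Γ ∧ IsSpinAdaptedPair γ Γ :=
  (isNecessaryInSpinClass_isDQGFeasibleSinglet n).and (isNecessaryInSpinClass_isSpinAdaptedPair n)

/-- The spin-adapted singlet `DQGT1T2′` condition set is singlet-class necessary.
[cite: Mazziotti2007RDMChapter, §II.F.1 eqs. (96)-(98)] -/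
theorem isNecessaryInSpinClass_isDQGT1T2PrimeFeasibleSinglet_spinAdapted (n : ℕ) :
    IsNecessaryInSpinClass (Λ := Λ) n n fun γ Γ =>
      IsDQGT1T2PrimeFeasibleSinglet n γ Γ ∧ IsSpinAdaptedPair γ Γ :=
  (isNecessaryInSpinClass_isDQGT1T2PrimeFeasibleSinglet n).and (isNecessaryInSpinClass_isSpinAdaptedPair n)

end Necessary

/-! ## §2 Singlet lower rows from the spin-adapted programmes -/

variable {k : ℕ}

/-- **SINGLET LOWER ROW FROM THE SPIN-ADAPTED `DQG` PROGRAMME.** Model `F`, `n ≤ k`, `lo` below the energy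
functional of `F`'s exact tables on every pair that is singlet-feasible (`IsDQGFeasibleSinglet n`) AND
spin-adapted (`IsSpinAdaptedPair`) ⇒ `SingletLowerRow F n lo`, i.e. `lo ≤ E₀(H_F; N = 2n, S = 0)`. No
symmetry hypothesis on `F`. The row form of `le_minEnergyOn_singlet_of_forall_spinAdapted`.
[cite: Mazziotti2007RDMChapter, §II.F.1 eqs. (96)-(98)] -/
theorem singletLowerRow_of_forall_spinAdapted {F : Model k} {n : ℕ} (hn : n ≤ k) {lo : ℚ}
    (hlo : ∀ γ Γ, IsDQGFeasibleSinglet n γ Γ → IsSpinAdaptedPair γ Γ → ((lo : ℚ) : ℝ) ≤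
      (rdmEnergy (fun p q => (F.h p q : ℂ)) (fun p q r s => (F.eri p q r s : ℂ)) (F.ecore : ℂ)
        γ Γ).re) :
    SingletLowerRow F n lo :=
  singletLowerRow_of_forall_necessary hn (isNecessaryInSpinClass_isDQGFeasibleSinglet_spinAdapted n)
    fun γ Γ h => hlo γ Γ h.1 h.2

/-- **SINGLET LOWER ROW FROM THE SPIN-ADAPTED `DQGT1T2′` PROGRAMME** (same, three-index rung).
[cite: Mazziotti2007RDMChapter, §II.F.1 eqs. (96)-(98)] -/
theorem singletLowerRow_of_forall_spinAdapted_t1t2p {F : Model k} {n : ℕ} (hn : n ≤ k) {lo : ℚ}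
    (hlo : ∀ γ Γ, IsDQGT1T2PrimeFeasibleSinglet n γ Γ → IsSpinAdaptedPair γ Γ → ((lo : ℚ) : ℝ) ≤
      (rdmEnergy (fun p q => (F.h p q : ℂ)) (fun p q r s => (F.eri p q r s : ℂ)) (F.ecore : ℂ)
        γ Γ).re) :
    SingletLowerRow F n lo :=
  singletLowerRow_of_forall_necessary hn
    (isNecessaryInSpinClass_isDQGT1T2PrimeFeasibleSinglet_spinAdapted n) fun γ Γ h => hlo γ Γ h.1 h.2

/-- **SINGLET LOWER ROW FROM THE SIX-BLOCK INSTANCE.** `lo` below `Re E_F` on every pair carrying the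
singlet rows, the `IsSpinAdaptedPair` relations and the six spin-coupled blocks `Γ⁰, Γ¹, 𝒬⁰, 𝒬¹, 𝒢⁰, 𝒢¹
⪰ 0` (the positivity rows a singlet-adapted instance carries — they hold on spin-adapted singlet-feasible
pairs, `spinAdaptedBlocks_of_isDQGFeasibleSinglet`) ⇒ `SingletLowerRow F n lo`. "Only two distinct blocks
must be constrained" per condition. [cite: Mazziotti2007RDMChapter, §II.F pp. 47-49] -/
theorem singletLowerRow_of_forall_sixBlocks {F : Model k} {n : ℕ} (hn : n ≤ k) {lo : ℚ}
    (hlo : ∀ γ Γ, IsDQGFeasibleSinglet n γ Γ → IsSpinAdaptedPair γ Γ →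
      (ppSingletBlock Γ).PosSemidef → (ppTripletBlock Γ).PosSemidef →
      (ppSingletBlock (qMap γ Γ)).PosSemidef → (ppTripletBlock (qMap γ Γ)).PosSemidef →
      (phSingletBlock (gMap γ Γ)).PosSemidef → (phTripletBlock (gMap γ Γ)).PosSemidef →
      ((lo : ℚ) : ℝ) ≤ (rdmEnergy (fun p q => (F.h p q : ℂ)) (fun p q r s => (F.eri p q r s : ℂ))
        (F.ecore : ℂ) γ Γ).re) :
    SingletLowerRow F n lo :=
  singletLowerRow_of_forall_spinAdapted hn fun γ Γ hf ha => by
    obtain ⟨h1, h2, h3, h4, h5, h6⟩ := spinAdaptedBlocks_of_isDQGFeasibleSinglet hf ha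
    exact hlo γ Γ hf ha h1 h2 h3 h4 h5 h6

/-! ## §3 The spin-adapted rows lose nothing -/

/-- **NOTHING IS LOST (`DQG` rung).** For `F`'s tables and `n ≤ k`: `lo` lies below `Re E_F` on the
spin-adapted singlet-feasible pairs iff `lo ≤ E_PQG(2n, S = 0)` of the PRINTED (unadapted) singlet
programme — the hypothesis of `singletLowerRow_of_forall_spinAdapted` is exactly as strong as that of
`singletLowerRow_of_forall_isDQGFeasibleSinglet`. [cite: GatermannParrilo2004, §3 Thm 3.3] -/
theorem forall_spinAdapted_iff_le_pqgSingletEnergy (F : Model k) {n : ℕ} (hn : n ≤ k) (lo : ℝ) :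
    (∀ γ Γ, IsDQGFeasibleSinglet n γ Γ → IsSpinAdaptedPair γ Γ → lo ≤
      (rdmEnergy (fun p q => (F.h p q : ℂ)) (fun p q r s => (F.eri p q r s : ℂ)) (F.ecore : ℂ)
        γ Γ).re) ↔
      lo ≤ pqgSingletEnergy (fun p q => (F.h p q : ℂ)) (fun p q r s => (F.eri p q r s : ℂ))
        (F.ecore : ℂ) n :=
  (le_pqgSingletEnergy_iff_spinAdapted _ _ _ (by simpa using hn) lo).symm

/-- **NOTHING IS LOST (`PQGT1T2′` rung).** [cite: GatermannParrilo2004, §3 Thm 3.3] -/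
theorem forall_spinAdapted_t1t2p_iff_le_pqgT1T2pSingletEnergy (F : Model k) {n : ℕ} (hn : n ≤ k)
    (lo : ℝ) :
    (∀ γ Γ, IsDQGT1T2PrimeFeasibleSinglet n γ Γ → IsSpinAdaptedPair γ Γ → lo ≤
      (rdmEnergy (fun p q => (F.h p q : ℂ)) (fun p q r s => (F.eri p q r s : ℂ)) (F.ecore : ℂ)
        γ Γ).re) ↔
      lo ≤ pqgT1T2pSingletEnergy (fun p q => (F.h p q : ℂ)) (fun p q r s => (F.eri p q r s : ℂ))
        (F.ecore : ℂ) n :=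
  (le_pqgT1T2pSingletEnergy_iff_spinAdapted _ _ _ (by simpa using hn) lo).symm

/-- **The best spin-adapted `DQG` row is the printed value itself**: `E_PQG(2n, S = 0)` of `F`'s tables is
a singlet lower bound of the model, `E_PQG(2n, S=0) ≤ E₀(H_F; 2n, S=0)` (`n ≤ k`) — and by
`forall_spinAdapted_iff_le_pqgSingletEnergy` no spin-adapted certificate can claim more at this rung.
[cite: Mazziotti2007RDMChapter, §II.F.1 eqs. (96)-(98)] -/
theorem pqgSingletEnergy_le_singletEnergy (F : Model k) {n : ℕ} (hn : n ≤ k) :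
    pqgSingletEnergy (fun p q => (F.h p q : ℂ)) (fun p q r s => (F.eri p q r s : ℂ)) (F.ecore : ℂ) n ≤
      F.singletEnergy n :=
  pqgSingletEnergy_le_minEnergyOn_singlet _ _ _ (by simpa using hn)

end Summit.Ventures.CertifiedQuantumChemistry

end
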